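import Summits.Ventures.Crystal3D.Theorems.StickyWulffConstantPolycrystalWulffBoundFreeEnergyExterior

/-!
# `PolycrystalWulffBound`: inclusion–exclusion for a SUB-FAMILY of grains (merging classes)

Route `StickyWulffConstant` of the venture `Summits/Ventures/Crystal3D`, crux `PolycrystalWulffBound`
(item `stmt-Ventures-19482`), second prover lane (poly-p2).  For pairwise disjoint polyhedral grains
`G : Fin n → Set E3` of finite volume, an origin-symmetric compact convex body `K ∋ 0`, and ANY
index set `I : Finset (Fin n)`:

  `per K (⋃_{f ∈ I} G f) = Σ_{f ∈ I} per K (G f) − Σ_{f, g ∈ I, f ≠ g} ι_K(G f, G g)`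

(`per_biUnion_eq_sum_sub_sum_iota`; the wall identity `sum_iota_eq_sum_per_sub_per` applied to the
MASKED texture `f ↦ if f ∈ I then G f else ∅`, whose empty grains carry no perimeter and no
interface).  This is the bookkeeping of MERGING a class of grains into one grain (P-LINE §1, §3:
lattice classes; `rung_twinFree`'s merging step): the perimeter of the merged grain, its volume
(`subfamily_union_facts`: measurable, finite volume and perimeter, `|⋃_I G| = Σ_I |G f|`).
Also `per_empty`, `iota_empty_left/right`.
WHAT THIS IS NOT: a result on grains in contact beyond bookkeeping; the crux is not claimed.
-/

noncomputable section

namespace Summit.Ventures.Crystal3D.Theorems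

open MeasureTheory Set Metric
open scoped RealInnerProductSpace ENNReal Pointwise
open Summit.Ventures.Crystal3D.Cruxes.TextureLiminf.TexShadow
open Literature.Analysis.Convexity
open Literature.MathematicalPhysics.StatisticalMechanics (perimeter HasFinitePerimeter)

/-- The empty set has zero `K`-perimeter. -/
theorem per_empty (K : Set E3) : per K (∅ : Set E3) = 0 := by
  unfold per
  rw [perK_eq_anisotropicPerimeter, anisotropicPerimeter_empty, ENNReal.toReal_zero]

/-- The interface term with an empty first set vanishes. -/
theorem iota_empty_left (K S : Set E3) : per K (∅ : Set E3) + per K S - per K (∅ ∪ S) = 0 := by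
  rw [per_empty, empty_union]; ring

/-- The interface term with an empty second set vanishes. -/
theorem iota_empty_right (K S : Set E3) : per K S + per K (∅ : Set E3) - per K (S ∪ ∅) = 0 := by
  rw [per_empty, union_empty]; ring

/-- The empty set is polyhedral (an empty union of polytopes). -/
theorem empty_eq_iUnion_polytope :
    ∃ (k : ℕ) (H : Fin k → Finset (E3 × ℝ)), (∅ : Set E3) = ⋃ i, polytope (H i) :=
  ⟨0, fun i => Fin.elim0 i, by rw [iUnion_of_empty]⟩

/-- The empty set has finite perimeter. -/
theorem hasFinitePerimeter_empty : HasFinitePerimeter (∅ : Set E3) := by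
  refine ⟨MeasurableSet.empty, ?_⟩
  rw [perimeter_eq_anisotropicPerimeter_closedBall, anisotropicPerimeter_empty]
  exact ENNReal.zero_lt_top

/-- The masked texture: the union of `f ↦ if f ∈ I then G f else ∅` is `⋃_{f ∈ I} G f`. -/
theorem iUnion_ite_mem_eq_biUnion {n : ℕ} (G : Fin n → Set E3) (I : Finset (Fin n)) :
    (⋃ f, (if f ∈ I then G f else ∅)) = ⋃ f ∈ I, G f := by
  ext x
  simp only [mem_iUnion, mem_ite_empty_right, exists_prop]

/-- **A sub-family of a texture: measurable, finite volume and perimeter, additive volume.**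
For pairwise disjoint grains of finite perimeter and finite volume and `I : Finset (Fin n)`,
`⋃_{f∈I} G f` is measurable with finite volume and perimeter and `|⋃_{f∈I} G f| = Σ_{f∈I} |G f|`. -/
theorem subfamily_union_facts {n : ℕ} (G : Fin n → Set E3)
    (hfin : ∀ f, HasFinitePerimeter (G f) ∧ volume (G f) < ⊤)
    (hdisj : ∀ f g, f ≠ g → Disjoint (G f) (G g)) (I : Finset (Fin n)) :
    MeasurableSet (⋃ f ∈ I, G f) ∧ volume (⋃ f ∈ I, G f) < ⊤ ∧ perimeter (⋃ f ∈ I, G f) ≠ ⊤ ∧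
      (volume (⋃ f ∈ I, G f)).toReal = ∑ f ∈ I, (volume (G f)).toReal := by
  classical
  set GI : Fin n → Set E3 := fun f => if f ∈ I then G f else ∅ with hGI
  have hfinI : ∀ f, HasFinitePerimeter (GI f) ∧ volume (GI f) < ⊤ := by
    intro f
    by_cases hf : f ∈ I
    · simp only [hGI, hf, if_true]; exact hfin f
    · simp only [hGI, hf, if_false]; exact ⟨hasFinitePerimeter_empty, by simp⟩
  have hdisjI : ∀ f g, f ≠ g → Disjoint (GI f) (GI g) := by
    intro f g hfg
    by_cases hf : f ∈ I
    · by_cases hg : g ∈ I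
      · simp only [hGI, hf, hg, if_true]; exact hdisj f g hfg
      · simp only [hGI, hg, if_false]; exact disjoint_empty _
    · simp only [hGI, hf, if_false]; exact empty_disjoint _
  obtain ⟨h1, h2, h3, h4⟩ := texture_union_facts GI hfinI hdisjI
  have hU : (⋃ f, GI f) = ⋃ f ∈ I, G f := iUnion_ite_mem_eq_biUnion G I
  rw [hU] at h1 h2 h3 h4
  refine ⟨h1, h2, h3, ?_⟩
  rw [h4]
  have hv : ∀ f, (volume (GI f)).toReal = if f ∈ I then (volume (G f)).toReal else 0 := by
    intro f
    by_cases hf : f ∈ I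
    · simp only [hGI, hf, if_true]
    · simp only [hGI, hf, if_false, measure_empty, ENNReal.toReal_zero]
  simp_rw [hv]
  rw [Finset.sum_ite_mem, Finset.univ_inter]

/-- **Inclusion–exclusion for a sub-family (merging a class of grains).**  For pairwise disjoint
polyhedral grains of finite volume, an origin-symmetric compact convex body `K ∋ 0` and
`I : Finset (Fin n)`:
`per K (⋃_{f∈I} G f) = Σ_{f∈I} per K (G f) − Σ_{f∈I} Σ_{g∈I} (if f = g then 0 else ι_K(G f, G g))`,
`ι_K(S₁, S₂) = (per K S₁ + per K S₂ − per K (S₁ ∪ S₂))/2`. -/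
theorem per_biUnion_eq_sum_sub_sum_iota {n : ℕ} (G : Fin n → Set E3)
    (hPoly : ∀ f, ∃ (k : ℕ) (H : Fin k → Finset (E3 × ℝ)), G f = ⋃ i, polytope (H i))
    (hvol : ∀ f, volume (G f) < ⊤) (hdisjG : ∀ f g, f ≠ g → Disjoint (G f) (G g))
    {K : Set E3} (hK : IsCompact K) (hKc : Convex ℝ K) (h0 : (0 : E3) ∈ K) (hKs : -K = K)
    (I : Finset (Fin n)) :
    per K (⋃ f ∈ I, G f) = (∑ f ∈ I, per K (G f)) -
      ∑ f ∈ I, ∑ g ∈ I, (if f = g then 0 else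
        (per K (G f) + per K (G g) - per K (G f ∪ G g)) / 2) := by
  classical
  set GI : Fin n → Set E3 := fun f => if f ∈ I then G f else ∅ with hGI
  have hPolyI : ∀ f, ∃ (k : ℕ) (H : Fin k → Finset (E3 × ℝ)), GI f = ⋃ i, polytope (H i) := by
    intro f
    by_cases hf : f ∈ I
    · simp only [hGI, hf, if_true]; exact hPoly f
    · simp only [hGI, hf, if_false]; exact empty_eq_iUnion_polytope
  have hvolI : ∀ f, volume (GI f) < ⊤ := by
    intro f
    by_cases hf : f ∈ I
    · simp only [hGI, hf, if_true]; exact hvol f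
    · simp only [hGI, hf, if_false, measure_empty]; exact ENNReal.zero_lt_top
  have hdisjI : ∀ f g, f ≠ g → Disjoint (GI f) (GI g) := by
    intro f g hfg
    by_cases hf : f ∈ I
    · by_cases hg : g ∈ I
      · simp only [hGI, hf, hg, if_true]; exact hdisjG f g hfg
      · simp only [hGI, hg, if_false]; exact disjoint_empty _
    · simp only [hGI, hf, if_false]; exact empty_disjoint _
  have h := sum_iota_eq_sum_per_sub_per GI hPolyI hvolI hdisjI hK hKc h0 hKs
  rw [iUnion_ite_mem_eq_biUnion G I] at h
  -- the perimeters of the masked grains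
  have hper : ∀ f, per K (GI f) = if f ∈ I then per K (G f) else 0 := by
    intro f
    by_cases hf : f ∈ I
    · simp only [hGI, hf, if_true]
    · simp only [hGI, hf, if_false, per_empty]
  -- the interface terms of the masked grains
  have hterm : ∀ f g, (if f = g then 0 else (per K (GI f) + per K (GI g) - per K (GI f ∪ GI g)) / 2)
      = if f ∈ I then (if g ∈ I then
          (if f = g then 0 else (per K (G f) + per K (G g) - per K (G f ∪ G g)) / 2) else 0)
        else 0 := by
    intro f g
    by_cases hf : f ∈ I
    · by_cases hg : g ∈ I
      · simp only [hGI, hf, hg, if_true]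
      · simp only [hGI, hf, hg, if_true, if_false, iota_empty_right, zero_div, ite_self]
    · simp only [hGI, hf, if_false]
      by_cases hfg : f = g
      · rw [if_pos hfg]
      · rw [if_neg hfg]
        by_cases hg : g ∈ I
        · simp only [hg, if_true, iota_empty_left, zero_div]
        · simp only [hg, if_false, iota_empty_left, zero_div]
  simp_rw [hterm, hper] at h
  rw [Finset.sum_ite_mem, Finset.univ_inter] at h
  have h2 : (∑ x, ∑ y, if x ∈ I then (if y ∈ I then
      (if x = y then 0 else (per K (G x) + per K (G y) - per K (G x ∪ G y)) / 2) else 0) else 0) =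
      ∑ x ∈ I, ∑ y ∈ I,
        (if x = y then 0 else (per K (G x) + per K (G y) - per K (G x ∪ G y)) / 2) := by
    calc (∑ x, ∑ y, if x ∈ I then (if y ∈ I then
          (if x = y then 0 else (per K (G x) + per K (G y) - per K (G x ∪ G y)) / 2) else 0) else 0)
        = ∑ x, (if x ∈ I then ∑ y, (if y ∈ I then
          (if x = y then 0 else (per K (G x) + per K (G y) - per K (G x ∪ G y)) / 2) else 0)
            else 0) := by
          refine Finset.sum_congr rfl fun x _ => ?_
          split_ifs with hx
          · rfl
          · simp
      _ = ∑ x ∈ I, ∑ y, (if y ∈ I then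
          (if x = y then 0 else (per K (G x) + per K (G y) - per K (G x ∪ G y)) / 2) else 0) := by
          rw [Finset.sum_ite_mem, Finset.univ_inter]
      _ = _ := by
          refine Finset.sum_congr rfl fun x _ => ?_
          rw [Finset.sum_ite_mem, Finset.univ_inter]
  rw [h2] at h
  linarith

end Summit.Ventures.Crystal3D.Theorems

end
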